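import Mathlib
import Summits.Parity.BatemanHorn.Theorems.IsogenyRedeiSplitBlockJacobiPureDigitPiecesPV
import HarnessLib

/-!
# Route `IsogenyRedei`, crux `SplitBlockJacobi` (stmt-Parity-11583), line `split-mass-middle-prime`:
# the pure digit pieces in the Pólya–Vinogradov range, power-saving form
# (partial result towards `stub_pureDigitPiecesPow`)

The registered stub `stub_pureDigitPiecesPow` (reshape r1 of `stub_pureDigitPieces`) of the line
skeleton asks, for `1/2 < θ < θ′ < 1`, `0 < η`, `θ′ + η < 1`, for a **power saving**
`O(x^{1-δ})`, `δ > 0`, in the `ℓ¹`-sum over `(Q, ν, k, a)` — primes `x^θ < Q ≤ x^{θ′}`, roots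
`ν² ≡ −1 (mod Q)`, moduli `1 ≤ k ≤ x^η`, root classes `a mod k` — of the absolute values of the
digit-character sums `Σ_{u : ν + Q(a+ku) ≤ x} ((ν²+1)/Q + 2ν(a+ku) | Q)`.

This file proves the statement with the hypothesis `θ′ + η < 1` replaced by the
**Pólya–Vinogradov range condition** `θ′/2 < 1 − θ′ − η` (i.e. `s := 3θ′/2 + η < 1`):
`pureDigitPiecesPow_of_polyaVinogradov_range`, with the explicit saving `δ = (1 − s)/2`.
It is a `--supports` helper; it does NOT close the stub (whose remaining range
`1 − θ′ − η ≤ θ′/2` needs Burgess's bound, Iwaniec–Kowalski Thm 12.6, not in the tree, for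
`θ′/4 < 1 − θ′ − η`, and is open beyond that).

## Proof

The tree file `IsogenyRedeiSplitBlockJacobiPureDigitPiecesPV` proves the `o(x)` version through the
eventual majorant `4C · x^s · (1 + log x)`; that majorant is internal to its proof, so it is restated
here as `pow_sum_le_majorant` (same proof: Pólya–Vinogradov for each inner sum, `abs_inner_le`, and
the bookkeeping `sum_sum_sum_sum_le` with `card_filter_range_dvd_sq_add_one_le_rho`,
`Iwaniec1978.exists_sum_rho_le`, `Iwaniec1978.rho_le_two`), packaged as
`pow_isBigO_majorant`.  The logarithm is absorbed by `x^s (1 + log x) = O(x^{s+ε})` for every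
`ε > 0` (`pow_isBigO_rpow_mul_one_add_log`, from Mathlib's `isLittleO_log_rpow_atTop`), and
`ε = (1 − s)/2` gives `s + ε = 1 − δ`.

No new definitions; everything is proved (no named facts).
-/

noncomputable section

open Filter Finset Asymptotics
open scoped Classical

open Literature.NumberTheory.Sieve.Iwaniec1978 (rho rho_le_two exists_sum_rho_le)

namespace Summit.Parity.BatemanHorn.Cruxes.SplitBlockJacobi.SplitMassMiddlePrime

/-! ### The explicit majorant -/

/-- **The explicit majorant of the pure digit pieces.** For `0 < η ≤ θ`, `0 < θ′` and a constant
`C ≥ 0` with `Σ_{m ≤ y} ρ(m) ≤ C y` (`y ≥ 2`), eventually in `x : ℕ` the `ℓ¹`-sum over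
`(Q, ν, k, a)` of the absolute digit-character sums is `≤ 4C · x^{θ′ + η + θ′/2} · (1 + log x)`:
each inner sum is `≤ √Q (1 + log Q) ≤ x^{θ′/2}(1 + log x)` by Pólya–Vinogradov (`abs_inner_le`),
and there are `≤ 2x^{θ′} · 2 · C x^η` index triples weighted by root classes
(`sum_sum_sum_sum_le`).  This is the majorant step of the tree's
`pureDigitPieces_of_polyaVinogradov_range`, exposed as a lemma. [folklore] -/
theorem pow_sum_le_majorant {θ θ' η C : ℝ} (hθ0 : 0 < θ) (hθ'0 : 0 < θ') (hη : 0 < η)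
    (hηθ : η ≤ θ) (hC0 : 0 ≤ C)
    (hC : ∀ y : ℝ, 2 ≤ y → ∑ m ∈ Finset.Icc 1 ⌊y⌋₊, (rho m : ℝ) ≤ C * y) :
    ∀ᶠ x : ℕ in atTop,
      ∑ Q ∈ (Finset.range (x + 1)).filter
          (fun Q : ℕ => Q.Prime ∧ (x : ℝ) ^ θ < (Q : ℝ) ∧ (Q : ℝ) ≤ (x : ℝ) ^ θ'),
        ∑ ν ∈ (Finset.range Q).filter (fun ν : ℕ => Q ∣ ν ^ 2 + 1),
          ∑ k ∈ (Finset.Icc 1 x).filter (fun k : ℕ => (k : ℝ) ≤ (x : ℝ) ^ η),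
            ∑ a ∈ (Finset.range k).filter (fun a : ℕ => Q * k ∣ (ν + Q * a) ^ 2 + 1),
              |∑ u ∈ (Finset.range (x + 1)).filter (fun u : ℕ => ν + Q * (a + k * u) ≤ x),
                  (jacobiSym (((ν ^ 2 + 1) / Q + 2 * ν * (a + k * u) : ℕ) : ℤ) Q : ℝ)| ≤
        4 * C * ((x : ℝ) ^ (θ' + η + θ' / 2) * (1 + Real.log x)) := by
  have hev_η : ∀ᶠ x : ℕ in atTop, (2 : ℝ) ≤ (x : ℝ) ^ η :=
    ((tendsto_rpow_atTop hη).comp tendsto_natCast_atTop_atTop).eventually_ge_atTop 2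
  have hev_θ : ∀ᶠ x : ℕ in atTop, (2 : ℝ) ≤ (x : ℝ) ^ θ :=
    ((tendsto_rpow_atTop hθ0).comp tendsto_natCast_atTop_atTop).eventually_ge_atTop 2
  filter_upwards [eventually_ge_atTop 1, hev_η, hev_θ] with x hx1 hxη hxθ
  have hx0 : (0 : ℝ) < x := by exact_mod_cast hx1
  have hx1' : (1 : ℝ) ≤ x := by exact_mod_cast hx1
  have hxηθ : (x : ℝ) ^ η ≤ (x : ℝ) ^ θ := Real.rpow_le_rpow_of_exponent_le hx1' hηθ
  set B : ℝ := (x : ℝ) ^ (θ' / 2) * (1 + Real.log x) with hB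
  have hB0 : 0 ≤ B := by positivity
  refine (sum_sum_sum_sum_le (R := C * (x : ℝ) ^ η) (N := 2 * (x : ℝ) ^ θ') hB0
    ?_ ?_ ?_ ?_ ?_ (by positivity)).trans (le_of_eq ?_)
  · -- the inner sums: Pólya–Vinogradov
    intro Q hQ ν hν k hk a _
    simp only [Finset.mem_filter, Finset.mem_range, Finset.mem_Icc] at hQ hν hk
    obtain ⟨hQx, hQp, hQθ, hQθ'⟩ := hQ
    have h2Q : 2 < Q := by exact_mod_cast hxθ.trans_lt hQθ
    have hkQ : k < Q := by exact_mod_cast (hk.2.trans hxηθ).trans_lt hQθ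
    have hβ : ¬ Q ∣ 2 * ν * k := not_dvd_two_mul_mul hQp h2Q hν.2 hk.1.1 hkQ
    refine (abs_inner_le hQp (by omega) hβ).trans ?_
    have hQpos : (0 : ℝ) < Q := by exact_mod_cast hQp.pos
    have hQx' : (Q : ℝ) ≤ x := by exact_mod_cast Nat.lt_succ_iff.1 hQx
    have hsqrt : Real.sqrt Q ≤ (x : ℝ) ^ (θ' / 2) := by
      calc Real.sqrt Q ≤ Real.sqrt ((x : ℝ) ^ θ') := Real.sqrt_le_sqrt hQθ'
        _ = (x : ℝ) ^ (θ' / 2) := by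
            rw [Real.sqrt_eq_rpow, ← Real.rpow_mul hx0.le]; congr 1; ring
    exact mul_le_mul hsqrt (by linarith [Real.log_le_log hQpos hQx'])
      (by positivity) (by positivity)
  · -- the root classes `a mod k`
    intro Q hQ ν _ k hk
    simp only [Finset.mem_filter, Finset.mem_range, Finset.mem_Icc] at hQ hk
    obtain ⟨_, hQp, hQθ, _⟩ := hQ
    have hkQ : k < Q := by exact_mod_cast (hk.2.trans hxηθ).trans_lt hQθ
    have hcop : Q.Coprime k :=
      (Nat.Prime.coprime_iff_not_dvd hQp).2 fun h => absurd (Nat.le_of_dvd (by omega) h) (by omega)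
    exact_mod_cast card_filter_range_dvd_sq_add_one_le_rho hcop ν
  · -- `Σ_{k ≤ x^η} ρ(k) ≤ C x^η`
    calc ∑ k ∈ (Finset.Icc 1 x).filter (fun k : ℕ => (k : ℝ) ≤ (x : ℝ) ^ η), (rho k : ℝ)
        ≤ ∑ k ∈ Finset.Icc 1 ⌊(x : ℝ) ^ η⌋₊, (rho k : ℝ) := by
          refine Finset.sum_le_sum_of_subset_of_nonneg (fun k hk => ?_) fun _ _ _ =>
            Nat.cast_nonneg _
          simp only [Finset.mem_filter, Finset.mem_Icc] at hk ⊢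
          exact ⟨hk.1.1, Nat.le_floor hk.2⟩
      _ ≤ C * (x : ℝ) ^ η := hC _ hxη
  · -- two roots `ν` per prime `Q`
    intro Q hQ
    simp only [Finset.mem_filter, Finset.mem_range] at hQ
    exact_mod_cast rho_le_two hQ.2.1
  · -- the number of primes `Q ≤ x^{θ'}`
    have hsub : (Finset.range (x + 1)).filter
        (fun Q : ℕ => Q.Prime ∧ (x : ℝ) ^ θ < (Q : ℝ) ∧ (Q : ℝ) ≤ (x : ℝ) ^ θ') ⊆
        Finset.range (⌊(x : ℝ) ^ θ'⌋₊ + 1) := by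
      intro Q hQ
      simp only [Finset.mem_filter, Finset.mem_range] at hQ ⊢
      exact Nat.lt_succ_of_le (Nat.le_floor hQ.2.2.2)
    calc (((Finset.range (x + 1)).filter
          (fun Q : ℕ => Q.Prime ∧ (x : ℝ) ^ θ < (Q : ℝ) ∧ (Q : ℝ) ≤ (x : ℝ) ^ θ')).card : ℝ)
        ≤ ((Finset.range (⌊(x : ℝ) ^ θ'⌋₊ + 1)).card : ℝ) := by
          exact_mod_cast Finset.card_le_card hsub
      _ = (⌊(x : ℝ) ^ θ'⌋₊ : ℝ) + 1 := by rw [Finset.card_range]; push_cast; ring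
      _ ≤ (x : ℝ) ^ θ' + 1 := by gcongr; exact Nat.floor_le (by positivity)
      _ ≤ 2 * (x : ℝ) ^ θ' := by have := Real.one_le_rpow hx1' hθ'0.le; linarith
  · -- `2x^{θ'} · 2 · C x^η · x^{θ'/2}(1 + log x) = 4C x^{θ' + η + θ'/2} (1 + log x)`
    rw [hB, Real.rpow_add hx0, Real.rpow_add hx0]; ring

/-- **`O`-form of the majorant.** For `0 < η ≤ θ` and `0 < θ′` the `ℓ¹`-sum of the pure digit
pieces is `O(x^{θ′ + η + θ′/2} (1 + log x))` along `x : ℕ → ∞` (from `pow_sum_le_majorant` with the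
constant of `Iwaniec1978.exists_sum_rho_le`). [folklore] -/
theorem pow_isBigO_majorant {θ θ' η : ℝ} (hθ0 : 0 < θ) (hθ'0 : 0 < θ') (hη : 0 < η)
    (hηθ : η ≤ θ) :
    (fun x : ℕ =>
      ∑ Q ∈ (Finset.range (x + 1)).filter
          (fun Q : ℕ => Q.Prime ∧ (x : ℝ) ^ θ < (Q : ℝ) ∧ (Q : ℝ) ≤ (x : ℝ) ^ θ'),
        ∑ ν ∈ (Finset.range Q).filter (fun ν : ℕ => Q ∣ ν ^ 2 + 1),
          ∑ k ∈ (Finset.Icc 1 x).filter (fun k : ℕ => (k : ℝ) ≤ (x : ℝ) ^ η),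
            ∑ a ∈ (Finset.range k).filter (fun a : ℕ => Q * k ∣ (ν + Q * a) ^ 2 + 1),
              |∑ u ∈ (Finset.range (x + 1)).filter (fun u : ℕ => ν + Q * (a + k * u) ≤ x),
                  (jacobiSym (((ν ^ 2 + 1) / Q + 2 * ν * (a + k * u) : ℕ) : ℤ) Q : ℝ)|)
      =O[Filter.atTop] fun x : ℕ => (x : ℝ) ^ (θ' + η + θ' / 2) * (1 + Real.log x) := by
  obtain ⟨C, hC0, hC⟩ := exists_sum_rho_le
  refine IsBigO.of_bound (4 * C) ?_
  filter_upwards [pow_sum_le_majorant hθ0 hθ'0 hη hηθ hC0.le hC] with x hx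
  rw [Real.norm_eq_abs, Real.norm_eq_abs, abs_of_nonneg (by positivity)]
  exact hx.trans (mul_le_mul_of_nonneg_left (le_abs_self _) (by positivity))

/-! ### Absorbing the logarithm -/

/-- **Log absorption.** For every `ε > 0`: `x^s (1 + log x) = O(x^{s + ε})` along `x : ℕ → ∞`
(indeed `1 + log y = o(y^ε)` on `ℝ`, Mathlib's `isLittleO_log_rpow_atTop`, times `y^s`, and
`y^s · y^ε = y^{s+ε}` for `y > 0`). [folklore] -/
theorem pow_isBigO_rpow_mul_one_add_log {s ε : ℝ} (hε : 0 < ε) :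
    (fun x : ℕ => (x : ℝ) ^ s * (1 + Real.log x)) =O[Filter.atTop]
      fun x : ℕ => (x : ℝ) ^ (s + ε) := by
  have hreal : (fun y : ℝ => y ^ s * (1 + Real.log y)) =O[atTop] fun y : ℝ => y ^ (s + ε) := by
    have h1 : (fun y : ℝ => 1 + Real.log y) =o[atTop] fun y : ℝ => y ^ ε := by
      refine IsLittleO.add ?_ (isLittleO_log_rpow_atTop hε)
      exact isLittleO_const_left.2
        (Or.inr (tendsto_norm_atTop_atTop.comp (tendsto_rpow_atTop hε)))
    have h2 := (isBigO_refl (fun y : ℝ => y ^ s) atTop).mul_isLittleO h1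
    refine h2.isBigO.trans (IsBigO.of_bound 1 ?_)
    filter_upwards [eventually_gt_atTop 0] with y hy
    refine le_of_eq ?_
    rw [← Real.rpow_add hy, one_mul]
  exact hreal.comp_tendsto tendsto_natCast_atTop_atTop

/-! ### The theorem: `PureDigitPiecesPow` in the Pólya–Vinogradov range -/

/-- **The pure digit pieces have a power saving in the Pólya–Vinogradov range.** For
`1/2 < θ < θ′ < 1`, `0 < η` and `θ′/2 < 1 − θ′ − η` (i.e. `s := θ′ + η + θ′/2 < 1`, which implies
the stub's `θ′ + η < 1`) there is `δ > 0` — namely `δ = (1 − s)/2` — with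
`Σ_{x^θ<Q≤x^{θ′} prime} Σ_{ν²≡−1 (Q), ν<Q} Σ_{1≤k≤x^η} Σ_{a<k, Qk ∣ (ν+Qa)²+1}
   |Σ_{u ≤ x : ν + Q(a+ku) ≤ x} ((ν²+1)/Q + 2ν(a+ku) | Q)| = O(x^{1−δ})`.
The sum is `O(x^s (1 + log x))` (`pow_isBigO_majorant`: Pólya–Vinogradov for each inner sum and
root-class bookkeeping), and `x^s (1 + log x) = O(x^{s + (1−s)/2}) = O(x^{1−δ})`
(`pow_isBigO_rpow_mul_one_add_log`).  This is the literal statement of `stub_pureDigitPiecesPow`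
with its hypothesis `θ′ + η < 1` strengthened to the Pólya–Vinogradov range; the Burgess range
`θ′/4 < 1 − θ′ − η` would need Burgess's bound (Iwaniec–Kowalski Thm 12.6, not in the tree), and
beyond it the statement is open. [folklore] -/
theorem pureDigitPiecesPow_of_polyaVinogradov_range :
    ∀ θ θ' η : ℝ, 1 / 2 < θ → θ < θ' → θ' < 1 → 0 < η → θ' / 2 < 1 - θ' - η →
      ∃ δ : ℝ, 0 < δ ∧
        (fun x : ℕ =>
          ∑ Q ∈ (Finset.range (x + 1)).filter
              (fun Q : ℕ => Q.Prime ∧ (x : ℝ) ^ θ < (Q : ℝ) ∧ (Q : ℝ) ≤ (x : ℝ) ^ θ'),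
            ∑ ν ∈ (Finset.range Q).filter (fun ν : ℕ => Q ∣ ν ^ 2 + 1),
              ∑ k ∈ (Finset.Icc 1 x).filter (fun k : ℕ => (k : ℝ) ≤ (x : ℝ) ^ η),
                ∑ a ∈ (Finset.range k).filter (fun a : ℕ => Q * k ∣ (ν + Q * a) ^ 2 + 1),
                  |∑ u ∈ (Finset.range (x + 1)).filter (fun u : ℕ => ν + Q * (a + k * u) ≤ x),
                      (jacobiSym (((ν ^ 2 + 1) / Q + 2 * ν * (a + k * u) : ℕ) : ℤ) Q : ℝ)|)
          =O[Filter.atTop] fun x : ℕ => (x : ℝ) ^ (1 - δ) := by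
  intro θ θ' η hθ hθθ' hθ'1 hη hr
  refine ⟨(1 - (θ' + η + θ' / 2)) / 2, by linarith, ?_⟩
  refine (pow_isBigO_majorant (θ' := θ') (by linarith) (by linarith) hη (by linarith)).trans ?_
  have he : 1 - (1 - (θ' + η + θ' / 2)) / 2 =
      θ' + η + θ' / 2 + (1 - (θ' + η + θ' / 2)) / 2 := by ring
  rw [he]
  exact pow_isBigO_rpow_mul_one_add_log (by linarith)

end Summit.Parity.BatemanHorn.Cruxes.SplitBlockJacobi.SplitMassMiddlePrime

end
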